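import Summits.KontsevichZagierPeriods.KontsevichZagierPeriods.Theorems.RootDecompQuadraticDescentSurdPairsP2

/-!
# Census pairs #1 #2 (ℚ(√−7) surd), #24 #28 (dilog), #36 #37 (weight one) DECIDED in `KZ.relations` (route `RootDecompQuadraticDescent`, instances of crux stmt-KontsevichZagierPeriods-28994 `DescentTwoQ` / stmt-4280 `KZDimTwo`) · part 3/6

Cell `decomp-kz`, lens 6 (decomp-kz-lens-6 g8): the LINEAR-FIBRE STRATUM of the weight-2 box census decided by rules 1+2 in dimension 2 — general lemma `linFibre` (unfolding `s = (α(x)y+β(x))/β(x)` into a log band) + ONE base substitution by the Möbius involution `κ(t) = (1−t)/(1+t)` (`rel_subst`) + `rel_trans`; `pair1`, `pair2` (the ℚ(√−7) live benchmarks of 28994 rev 7), `pair24`, `pair28`, `pair36`, `pair37` (the latter with four `RFun.stokes` steps, rational primitives); packaged `surdPairs_decided`, `surdPairs_descentTwoQ_instances` (∀ R ⊇ relations) and `surdPairs_of_kzDimTwo` BY NAME.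

Source: `HOME/decomp-kz-lens-6/g8/SurdPairs.lean` sha256 a3f0c2d08098ea3e (1516 l; critic decomp-kz-crit-1 g2 CLEARED 2026-08-30T08:39:24Z, std axioms), split into 6 modules by the landing seat decomp-kz-census-1 g7 (contexts re-opened per part; generic docstrings added where the source had none; the route file is imported only by the last part, which proves the `KZDimTwo` corollaries BY NAME).  No `sorry`; standard axioms.  References: [cite: KontsevichZagier2001, §1.2].
-/

noncomputable section

open MeasureTheory Set MvPolynomial

namespace Summit.KontsevichZagierPeriods.RootDecompQuadraticDescent.SurdPairs

open Literature.NumberTheory.Transcendental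
open Literature.NumberTheory.Transcendental.KZ
open Literature.ModelTheory.ExponentialFields (IsSemialgebraic)

-- PRIVATE copy (landed twin lives in a farm-unbuilt module; dedup.landed): snoc2_zero, snoc2_one, init2_zero
/-- `snoc2_zero`: auxiliary theorem of the lens-6 development «surd» (instances of 28994/4280) — see the module docstring; verbatim from the lens file. -/
@[simp] private theorem snoc2_zero (x : Fin 1 → ℝ) (t : ℝ) : (Fin.snoc x t : Fin 2 → ℝ) 0 = x 0 := rfl

/-- `snoc2_one`: auxiliary theorem of the lens-6 development «surd» (instances of 28994/4280) — see the module docstring; verbatim from the lens file. -/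
@[simp] private theorem snoc2_one (x : Fin 1 → ℝ) (t : ℝ) : (Fin.snoc x t : Fin 2 → ℝ) 1 = t := rfl

/-- `init2_zero`: auxiliary theorem of the lens-6 development «surd» (instances of 28994/4280) — see the module docstring; verbatim from the lens file. -/
@[simp] private theorem init2_zero (z : Fin 2 → ℝ) : Fin.init z 0 = z 0 := rfl

/-- **The base involution** `t = κ(t')`: `LB(w, V_B) ≡ LB(w, V_A)` whenever `V_B = V_A ∘ κ` and
`w = (w ∘ κ)·|κ'|` on `[0,1]`. -/
theorem subst_κ (W : BaseWt 0 1) (VB VA : LogArg 0 1)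
    (hv : ∀ t ∈ Icc (0 : ℝ) 1, VB.v t = VA.v (κ t))
    (hh : ∀ t ∈ Icc (0 : ℝ) 1, W.w t = W.w (κ t) * (2 / (1 + t) ^ 2)) :
    KZ.of (LB 0 1 W VB) - KZ.of (LB 0 1 W VA) ∈ KZ.relations := by
  have hD : ∀ t ∈ Icc ((0 : ℚ) : ℝ) ((1 : ℚ) : ℝ), (0 : ℝ) < 1 + t := fun t ht => by
    linarith [(I01 ht).1]
  have hd : ∀ t ∈ Icc ((0 : ℚ) : ℝ) ((1 : ℚ) : ℝ), HasDerivAt κ (κd t) t := fun t ht =>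
    hasDerivAt_κ (hD t ht).ne'
  have hneg : ∀ t ∈ Icc ((0 : ℚ) : ℝ) ((1 : ℚ) : ℝ), κd t < 0 := fun t ht => by
    unfold κd; have := hD t ht
    exact div_neg_of_neg_of_pos (by norm_num) (by positivity)
  obtain ⟨hinj, himg⟩ := injOn_image_of_deriv_neg (by norm_num) hd hneg
  refine rel_subst W W VB VA κ κd (1 - X 0) (1 + X 0)
    (fun y hy => by have := hD (y 0) hy; simp only [map_add, map_one, aeval_X]; exact this.ne')
    (fun y _ => by simp [κ]) hd hinj (by rw [himg]; norm_num [κ]) (fun t ht => hv t ⟨(I01 ht).1, (I01 ht).2⟩)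
    fun t ht => ?_
  rw [hh t ⟨(I01 ht).1, (I01 ht).2⟩, abs_of_neg (hneg t ht), κd]
  ring

/-- `subst1`: auxiliary theorem of the lens-6 development «surd» (instances of 28994/4280) — see the module docstring; verbatim from the lens file. -/
theorem subst1 : KZ.of (LB 0 1 W1 VB1) - KZ.of (LB 0 1 W1 VA1) ∈ KZ.relations := by
  refine subst_κ W1 VB1 VA1 (fun t ht => ?_) (fun t ht => ?_)
  · have h : (1 : ℝ) + t ≠ 0 := by linarith [ht.1]
    have hq := (βB_pos t).ne'
    show vB1F t = vA1F (κ t)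
    rw [vA1F, nA1_κ h, βA_κ h, vB1F]
    field_simp
  · have h : (1 : ℝ) + t ≠ 0 := by linarith [ht.1]
    show w1F t = w1F (κ t) * (2 / (1 + t) ^ 2)
    rw [w1F, w1F, one_add_κ h]
    field_simp

/-- `subst2`: auxiliary theorem of the lens-6 development «surd» (instances of 28994/4280) — see the module docstring; verbatim from the lens file. -/
theorem subst2 : KZ.of (LB 0 1 W2 VB2) - KZ.of (LB 0 1 W2 VA2) ∈ KZ.relations := by
  refine subst_κ W2 VB2 VA2 (fun t ht => ?_) (fun t ht => ?_)
  · have h : (1 : ℝ) + t ≠ 0 := by linarith [ht.1]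
    have hq := (βB_pos t).ne'
    show vB2F t = vA2F (κ t)
    rw [vA2F, nA2_κ h, βA_κ h, vB2F]
    field_simp
  · have h : (1 : ℝ) + t ≠ 0 := by linarith [ht.1]
    show w2F t = w2F (κ t) * (2 / (1 + t) ^ 2)
    rw [w2F, w2F, two_add_two_κ h]
    field_simp
    ring

/-! ## §4 Census pairs #1 and #2 -/

/-- `1 + x + y + xy + 2y²` (census pair #1, first member). -/
def QA1 : MvPolynomial (Fin 2) ℚ := 1 + X 0 + X 1 + X 0 * X 1 + 2 * X 1 ^ 2
/-- `2 − x + y + x² + xy` (census pair #1, second member). -/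
def QB1 : MvPolynomial (Fin 2) ℚ := 2 - X 0 + X 1 + X 0 ^ 2 + X 0 * X 1
/-- `1 + x + 2y + 2x² + 2xy` (census pair #2, first member). -/
def QA2 : MvPolynomial (Fin 2) ℚ := 1 + X 0 + 2 * X 1 + 2 * X 0 ^ 2 + 2 * X 0 * X 1
/-- `2 − x + 2y + x² + 2xy` (census pair #2, second member). -/
def QB2 : MvPolynomial (Fin 2) ℚ := 2 - X 0 + 2 * X 1 + X 0 ^ 2 + 2 * X 0 * X 1

/-- `QA1_pos`: auxiliary theorem of the lens-6 development «surd» (instances of 28994/4280) — see the module docstring; verbatim from the lens file. -/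
private theorem QA1_pos {x : Fin 2 → ℝ} (hx : x ∈ cube 2) : 0 < aeval x QA1 := by
  have h0 := (hx 0).1; have h1 := (hx 1).1
  simp only [QA1, map_add, map_mul, map_pow, map_ofNat, map_one, aeval_X]
  nlinarith [mul_nonneg h0 h1, sq_nonneg (x 1)]
/-- `QB1_pos`: auxiliary theorem of the lens-6 development «surd» (instances of 28994/4280) — see the module docstring; verbatim from the lens file. -/
private theorem QB1_pos {x : Fin 2 → ℝ} (hx : x ∈ cube 2) : 0 < aeval x QB1 := by
  have h0 := (hx 0).1; have h0' := (hx 0).2; have h1 := (hx 1).1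
  simp only [QB1, map_add, map_sub, map_mul, map_pow, map_ofNat, aeval_X]
  nlinarith [mul_nonneg h0 h1, sq_nonneg (x 0)]
/-- `QA2_pos`: auxiliary theorem of the lens-6 development «surd» (instances of 28994/4280) — see the module docstring; verbatim from the lens file. -/
private theorem QA2_pos {x : Fin 2 → ℝ} (hx : x ∈ cube 2) : 0 < aeval x QA2 := by
  have h0 := (hx 0).1; have h1 := (hx 1).1
  simp only [QA2, map_add, map_mul, map_pow, map_ofNat, map_one, aeval_X]
  nlinarith [mul_nonneg h0 h1, sq_nonneg (x 0)]
/-- `QB2_pos`: auxiliary theorem of the lens-6 development «surd» (instances of 28994/4280) — see the module docstring; verbatim from the lens file. -/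
private theorem QB2_pos {x : Fin 2 → ℝ} (hx : x ∈ cube 2) : 0 < aeval x QB2 := by
  have h0 := (hx 0).1; have h0' := (hx 0).2; have h1 := (hx 1).1
  simp only [QB2, map_add, map_sub, map_mul, map_pow, map_ofNat, aeval_X]
  nlinarith [mul_nonneg h0 h1, sq_nonneg (x 0)]

/-- `[□², 1/(1+x+y+xy+2y²)]`. -/
def A1 : RFun 2 := ⟨1, QA1, fun _ hx => (QA1_pos hx).ne'⟩
/-- `[□², 1/(2−x+y+x²+xy)]`. -/
def B1 : RFun 2 := ⟨1, QB1, fun _ hx => (QB1_pos hx).ne'⟩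
/-- `[□², 1/(1+x+2y+2x²+2xy)]`. -/
def A2 : RFun 2 := ⟨1, QA2, fun _ hx => (QA2_pos hx).ne'⟩
/-- `[□², 1/(2−x+2y+x²+2xy)]`. -/
def B2 : RFun 2 := ⟨1, QB2, fun _ hx => (QB2_pos hx).ne'⟩

/-- `[□², 1/Q_{A1}] ≡ LB(1/(1+t), V_{A1})` after the relabelling `x ↔ y`
(`Q_{A1}(y,x) = (1+x)·y + (1+x+2x²)`). -/
theorem A1_band : KZ.of (A1.rename (Equiv.swap 0 1)).rep - KZ.of (LB 0 1 W1 VA1) ∈ KZ.relations := by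
  refine linFibre _ 1 (fun t => 1 + t) (fun t => 1 + t + 2 * t ^ 2) (1 + X 0) (1 + X 0 + 2 * X 0 ^ 2)
    (fun z => by simp) (fun z => by simp) (by fun_prop) (by fun_prop)
    (fun t ht => by linarith [ht.1]) (fun t _ => βA_pos t) (fun z _ => ?_) W1
    (fun t _ => by simp [W1, w1F]) VA1 (fun t _ => by simp only [VA1, mkArg_v, vA1F]; ring)
  rw [RFun.fn_rename]
  simp only [RFun.fn, A1, QA1, map_add, map_mul, map_pow, map_ofNat, map_one, aeval_X,
    Function.comp_apply, Equiv.swap_apply_left, Equiv.swap_apply_right]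
  ring

/-- `[□², 1/Q_{B1}] ≡ LB(1/(1+t), V_{B1})` (`Q_{B1} = (1+x)·y + (2−x+x²)`). -/
private theorem B1_band : KZ.of B1.rep - KZ.of (LB 0 1 W1 VB1) ∈ KZ.relations := by
  refine linFibre _ 1 (fun t => 1 + t) (fun t => 2 - t + t ^ 2) (1 + X 0) (2 - X 0 + X 0 ^ 2)
    (fun z => by simp) (fun z => by simp) (by fun_prop) (by fun_prop)
    (fun t ht => by linarith [ht.1]) (fun t _ => βB_pos t) (fun z _ => ?_) W1
    (fun t _ => by simp [W1, w1F]) VB1 (fun t _ => by simp only [VB1, mkArg_v, vB1F]; ring)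
  simp only [RFun.fn, B1, QB1, map_add, map_sub, map_mul, map_pow, map_ofNat, map_one, aeval_X]
  ring

/-- `[□², 1/Q_{A2}] ≡ LB(1/(2+2t), V_{A2})` (`Q_{A2} = (2+2x)·y + (1+x+2x²)`). -/
private theorem A2_band : KZ.of A2.rep - KZ.of (LB 0 1 W2 VA2) ∈ KZ.relations := by
  refine linFibre _ 1 (fun t => 2 + 2 * t) (fun t => 1 + t + 2 * t ^ 2) (2 + 2 * X 0)
    (1 + X 0 + 2 * X 0 ^ 2) (fun z => by simp) (fun z => by simp) (by fun_prop) (by fun_prop)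
    (fun t ht => by linarith [ht.1]) (fun t _ => βA_pos t) (fun z _ => ?_) W2
    (fun t _ => by simp [W2, w2F]) VA2 (fun t _ => by simp only [VA2, mkArg_v, vA2F]; ring)
  simp only [RFun.fn, A2, QA2, map_add, map_mul, map_pow, map_ofNat, map_one, aeval_X]
  ring

/-- `[□², 1/Q_{B2}] ≡ LB(1/(2+2t), V_{B2})` (`Q_{B2} = (2+2x)·y + (2−x+x²)`). -/
private theorem B2_band : KZ.of B2.rep - KZ.of (LB 0 1 W2 VB2) ∈ KZ.relations := by
  refine linFibre _ 1 (fun t => 2 + 2 * t) (fun t => 2 - t + t ^ 2) (2 + 2 * X 0) (2 - X 0 + X 0 ^ 2)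
    (fun z => by simp) (fun z => by simp) (by fun_prop) (by fun_prop)
    (fun t ht => by linarith [ht.1]) (fun t _ => βB_pos t) (fun z _ => ?_) W2
    (fun t _ => by simp [W2, w2F]) VB2 (fun t _ => by simp only [VB2, mkArg_v, vB2F]; ring)
  simp only [RFun.fn, B2, QB2, map_add, map_sub, map_mul, map_pow, map_ofNat, map_one, aeval_X]
  ring

/-- **Census pair #1 DECIDED**: `[□², 1/(1+x+y+xy+2y²)] − [□², 1/(2−x+y+x²+xy)] ∈ KZ.relations`
(relabel, two linear-fibre unfoldings, one base involution `κ`). -/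
theorem pair1 : KZ.of A1.rep - KZ.of B1.rep ∈ KZ.relations := by
  have h := sub_mem (sub_mem (add_mem (RFun.rel_rename A1 (Equiv.swap 0 1)) A1_band) subst1) B1_band
  convert h using 1
  abel

/-- **Census pair #2 DECIDED**: `[□², 1/(1+x+2y+2x²+2xy)] − [□², 1/(2−x+2y+x²+2xy)] ∈ KZ.relations`
(two linear-fibre unfoldings, one base involution `κ`). -/
theorem pair2 : KZ.of A2.rep - KZ.of B2.rep ∈ KZ.relations := by
  have h := sub_mem (sub_mem A2_band subst2) B2_band
  convert h using 1
  abel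

/-- `pair1_equivalent`: auxiliary theorem of the lens-6 development «surd» (instances of 28994/4280) — see the module docstring; verbatim from the lens file. -/
theorem pair1_equivalent : KZ.Equivalent A1.rep B1.rep := pair1
/-- `pair2_equivalent`: auxiliary theorem of the lens-6 development «surd» (instances of 28994/4280) — see the module docstring; verbatim from the lens file. -/
theorem pair2_equivalent : KZ.Equivalent A2.rep B2.rep := pair2

/-- `pair1_value`: auxiliary theorem of the lens-6 development «surd» (instances of 28994/4280) — see the module docstring; verbatim from the lens file. -/
theorem pair1_value : A1.rep.value = B1.rep.value := KZ.Equivalent.value_eq_holds pair1_equivalent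
/-- `pair2_value`: auxiliary theorem of the lens-6 development «surd» (instances of 28994/4280) — see the module docstring; verbatim from the lens file. -/
theorem pair2_value : A2.rep.value = B2.rep.value := KZ.Equivalent.value_eq_holds pair2_equivalent

/-! ## §4b The same involution decides census pairs #24 and #28 (`DILOG/DILOG · known value ·
UNEXPLAINED by folds`) — the other two linear-fibre pairs of the atlas matched by `κ` -/

/-- `two_add_κ`: auxiliary theorem of the lens-6 development «surd» (instances of 28994/4280) — see the module docstring; verbatim from the lens file. -/
private theorem two_add_κ {t : ℝ} (h : 1 + t ≠ 0) : 2 + κ t = (3 + t) / (1 + t) := by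
  unfold κ; field_simp; ring

/-- `[T + S] ≡ [T] + [S]` on the square (rule 1b). -/
theorem rel_lin (TS T S : RFun 2) (h : ∀ x ∈ cube 2, TS.fn x = T.fn x + S.fn x) :
    KZ.of TS.rep - KZ.of T.rep - KZ.of S.rep ∈ KZ.relations :=
  KZ.cubicalLinGens_subset_relations (KZ.mem_cubicalLinGens TS.isTameCube_rep T.isTameCube_rep
    S.isTameCube_rep fun x hx => by simpa using h x hx)

/-- `[2T] ≡ 2·[T]` on the square. -/
private theorem rel_double (T T2 : RFun 2) (h : ∀ x ∈ cube 2, T2.fn x = T.fn x + T.fn x) :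
    KZ.of T2.rep - 2 • KZ.of T.rep ∈ KZ.relations := by
  have h1 := rel_lin T2 T T h
  have : KZ.of T2.rep - 2 • KZ.of T.rep = KZ.of T2.rep - KZ.of T.rep - KZ.of T.rep := by abel
  rwa [this]

/-- `V_{A24} = (2+t)/(1+t)`. -/
def vA24F (t : ℝ) : ℝ := (2 + t) / (1 + t)
/-- `V_{B24} = (3+t)/2`. -/
def vB24F (t : ℝ) : ℝ := (3 + t) / 2
/-- `V_{A28} = 2 + t`. -/
def vA28F (t : ℝ) : ℝ := (2 + t) / 1
/-- `V_{B28} = (3+t)/(1+t)`. -/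
def vB28F (t : ℝ) : ℝ := (3 + t) / (1 + t)

/-- `aeval_one_add_ne`: auxiliary theorem of the lens-6 development «surd» (instances of 28994/4280) — see the module docstring; verbatim from the lens file. -/
private theorem aeval_one_add_ne {y : Fin 1 → ℝ} (hy : y ∈ ivl 0 1) :
    aeval y (1 + X 0 : MvPolynomial (Fin 1) ℚ) ≠ 0 := by
  have h0 := (I01 hy).1
  simp only [map_add, map_one, aeval_X]
  exact (show (0 : ℝ) < 1 + y 0 by linarith).ne'

/-- `VA24`: auxiliary def of the lens-6 development «surd» (instances of 28994/4280) — see the module docstring; verbatim from the lens file. -/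
def VA24 : LogArg 0 1 :=
  mkArg 0 1 vA24F (2 + X 0) (1 + X 0) (fun y hy => aeval_one_add_ne hy)
    (fun y _ => by simp [vA24F]) (fun t ht => by
      have h0 := (I01 ht).1
      unfold vA24F; rw [le_div_iff₀ (by linarith)]; linarith)
    ((by fun_prop : Continuous fun t : ℝ => 2 + t).continuousOn.div
      (by fun_prop : Continuous fun t : ℝ => 1 + t).continuousOn
      fun t ht => (show (0 : ℝ) < 1 + t by linarith [(I01 ht).1]).ne')
/-- `VB24`: auxiliary def of the lens-6 development «surd» (instances of 28994/4280) — see the module docstring; verbatim from the lens file. -/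
def VB24 : LogArg 0 1 :=
  mkArg 0 1 vB24F (3 + X 0) 2 (fun y _ => by simp)
    (fun y _ => by simp [vB24F]) (fun t ht => by
      have h0 := (I01 ht).1
      unfold vB24F; linarith)
    (by unfold vB24F; fun_prop)
/-- `VA28`: auxiliary def of the lens-6 development «surd» (instances of 28994/4280) — see the module docstring; verbatim from the lens file. -/
def VA28 : LogArg 0 1 :=
  mkArg 0 1 vA28F (2 + X 0) 1 (fun y _ => by simp)
    (fun y _ => by simp [vA28F]) (fun t ht => by
      have h0 := (I01 ht).1
      unfold vA28F; linarith)
    (by unfold vA28F; fun_prop)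
/-- `VB28`: auxiliary def of the lens-6 development «surd» (instances of 28994/4280) — see the module docstring; verbatim from the lens file. -/
def VB28 : LogArg 0 1 :=
  mkArg 0 1 vB28F (3 + X 0) (1 + X 0) (fun y hy => aeval_one_add_ne hy)
    (fun y _ => by simp [vB28F]) (fun t ht => by
      have h0 := (I01 ht).1
      unfold vB28F; rw [le_div_iff₀ (by linarith)]; linarith)
    ((by fun_prop : Continuous fun t : ℝ => 3 + t).continuousOn.div
      (by fun_prop : Continuous fun t : ℝ => 1 + t).continuousOn
      fun t ht => (show (0 : ℝ) < 1 + t by linarith [(I01 ht).1]).ne')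

/-- `subst24`: auxiliary theorem of the lens-6 development «surd» (instances of 28994/4280) — see the module docstring; verbatim from the lens file. -/
theorem subst24 : KZ.of (LB 0 1 W1 VB24) - KZ.of (LB 0 1 W1 VA24) ∈ KZ.relations := by
  refine subst_κ W1 VB24 VA24 (fun t ht => ?_) (fun t ht => ?_)
  · have h : (1 : ℝ) + t ≠ 0 := by linarith [ht.1]
    have h2 : (2 : ℝ) / (1 + t) ≠ 0 := div_ne_zero two_ne_zero h
    show vB24F t = vA24F (κ t)
    rw [vA24F, two_add_κ h, one_add_κ h, vB24F]
    field_simp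
  · have h : (1 : ℝ) + t ≠ 0 := by linarith [ht.1]
    show w1F t = w1F (κ t) * (2 / (1 + t) ^ 2)
    rw [w1F, w1F, one_add_κ h]
    field_simp

/-- `subst28`: auxiliary theorem of the lens-6 development «surd» (instances of 28994/4280) — see the module docstring; verbatim from the lens file. -/
theorem subst28 : KZ.of (LB 0 1 W1 VB28) - KZ.of (LB 0 1 W1 VA28) ∈ KZ.relations := by
  refine subst_κ W1 VB28 VA28 (fun t ht => ?_) (fun t ht => ?_)
  · have h : (1 : ℝ) + t ≠ 0 := by linarith [ht.1]
    show vB28F t = vA28F (κ t)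
    rw [vA28F, two_add_κ h, vB28F, div_one]
  · have h : (1 : ℝ) + t ≠ 0 := by linarith [ht.1]
    show w1F t = w1F (κ t) * (2 / (1 + t) ^ 2)
    rw [w1F, w1F, one_add_κ h]
    field_simp

/-- `1 + x + 2y + xy + y² = (1+y)(1+x+y)` (census pair #24, first member). -/
def QA24 : MvPolynomial (Fin 2) ℚ := 1 + X 0 + 2 * X 1 + X 0 * X 1 + X 1 ^ 2
/-- `2 + y + xy` (census pair #24, second member). -/
def QB24 : MvPolynomial (Fin 2) ℚ := 2 + X 1 + X 0 * X 1
/-- `1 + y + xy` (census pair #28, first member). -/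
def QA28 : MvPolynomial (Fin 2) ℚ := 1 + X 1 + X 0 * X 1
/-- `1 + 2x + 2y + 2xy + y² = (1+y)(1+2x+y)` (census pair #28, second member, coefficient 2). -/
def QB28 : MvPolynomial (Fin 2) ℚ := 1 + 2 * X 0 + 2 * X 1 + 2 * X 0 * X 1 + X 1 ^ 2

/-- `QA24_pos`: auxiliary theorem of the lens-6 development «surd» (instances of 28994/4280) — see the module docstring; verbatim from the lens file. -/
private theorem QA24_pos {x : Fin 2 → ℝ} (hx : x ∈ cube 2) : 0 < aeval x QA24 := by
  have h0 := (hx 0).1; have h1 := (hx 1).1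
  simp only [QA24, map_add, map_mul, map_pow, map_ofNat, map_one, aeval_X]
  nlinarith [mul_nonneg h0 h1, sq_nonneg (x 1)]
/-- `QB24_pos`: auxiliary theorem of the lens-6 development «surd» (instances of 28994/4280) — see the module docstring; verbatim from the lens file. -/
private theorem QB24_pos {x : Fin 2 → ℝ} (hx : x ∈ cube 2) : 0 < aeval x QB24 := by
  have h0 := (hx 0).1; have h1 := (hx 1).1
  simp only [QB24, map_add, map_mul, map_ofNat, aeval_X]
  nlinarith [mul_nonneg h0 h1]
/-- `QA28_pos`: auxiliary theorem of the lens-6 development «surd» (instances of 28994/4280) — see the module docstring; verbatim from the lens file. -/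
private theorem QA28_pos {x : Fin 2 → ℝ} (hx : x ∈ cube 2) : 0 < aeval x QA28 := by
  have h0 := (hx 0).1; have h1 := (hx 1).1
  simp only [QA28, map_add, map_mul, map_one, aeval_X]
  nlinarith [mul_nonneg h0 h1]
/-- `QB28_pos`: auxiliary theorem of the lens-6 development «surd» (instances of 28994/4280) — see the module docstring; verbatim from the lens file. -/
private theorem QB28_pos {x : Fin 2 → ℝ} (hx : x ∈ cube 2) : 0 < aeval x QB28 := by
  have h0 := (hx 0).1; have h1 := (hx 1).1
  simp only [QB28, map_add, map_mul, map_pow, map_ofNat, map_one, aeval_X]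
  nlinarith [mul_nonneg h0 h1, sq_nonneg (x 1)]

/-- `[□², 1/((1+y)(1+x+y))]`. -/
def A24 : RFun 2 := ⟨1, QA24, fun _ hx => (QA24_pos hx).ne'⟩
/-- `[□², 1/(2+y+xy)]`. -/
def B24 : RFun 2 := ⟨1, QB24, fun _ hx => (QB24_pos hx).ne'⟩
/-- `[□², 1/(1+y+xy)]`. -/
def A28 : RFun 2 := ⟨1, QA28, fun _ hx => (QA28_pos hx).ne'⟩
/-- `[□², 1/((1+y)(1+2x+y))]`. -/
def B28 : RFun 2 := ⟨1, QB28, fun _ hx => (QB28_pos hx).ne'⟩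
/-- `[□², 2/((1+y)(1+2x+y))]`. -/
def B28two : RFun 2 := ⟨2, QB28, fun _ hx => (QB28_pos hx).ne'⟩

end Summit.KontsevichZagierPeriods.RootDecompQuadraticDescent.SurdPairs

end
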